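import Literature.NumberTheory.Automorphic.MeyerRatTheta
import Literature.NumberTheory.Automorphic.MeyerUnramifiedReduction
import Mathlib.NumberTheory.Padics.HeightOneSpectrum
import Mathlib.NumberTheory.LSeries.PrimesInAP
import Mathlib.Data.ZMod.Units
import HarnessLib

/-!
# Meyer's global difference representation — proofs, `K = ℚ`: `Ẑˣ`-invariant Schwartz–Bruhat
# functions on the finite adeles, restricted to `ℚ`

Topic `NumberTheory/Automorphic`; namespace `Literature.NumberTheory.Automorphic.Meyer`. Sibling
PROOF file for the finite-adelic part of the plan for `Meyer.spectralRealisation_rat`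
[Meyer2005, Thm. 5.11] (structure of `𝒮(𝔸_{∁S})^{𝒪ˣ_{∁S}}`, [Meyer2005, §5.2, proof of Thm. 5.1:
"`𝒮(𝔸_{∁S})^{𝒪ˣ_{∁S}} ≅ C_c^∞(𝔸ˣ_{∁S}/𝒪ˣ_{∁S}) ≅ ℂ[Kˣ/Kˣ_S]`"], in the elementary form needed for
`K = ℚ`, `S = {∞}`).

For a locally constant compactly supported `Φ : 𝔸_ℚ^∞ → ℂ` invariant under `Ẑˣ = ∏_p ℤ_pˣ`
(`integralFiniteUnits ℚ`) we show that its values on the rationals are governed by a gcd-class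
sequence: there are `N₁, M ≥ 1` and `a : ℕ → ℂ` with `a(n) = a(gcd(n, M))` such that

  `Φ(m / N₁) = a(gcd(|m|, M))` for all integers `m ≠ 0`, and `Φ(q) = 0` unless `N₁ q ∈ ℤ`

(`exists_gcd_seq_of_invariant`). Ingredients: the level and the denominator of a Schwartz–Bruhat
function (`exists_level_of_mem_schwartzBruhat`, `exists_denominator_of_mem_schwartzBruhat`);
**Dirichlet's theorem on primes in arithmetic progressions** (Mathlib
`Nat.forall_exists_prime_gt_and_zmodEq`) to realise every unit residue `u mod M` by a prime
`p ∤ M`; the finite idele unit `û = p + (1 - p)δ_p ∈ Ẑˣ` (`primeUnit`), congruent to `p` modulo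
`M Ẑ`, which converts `Ẑˣ`-invariance into `a(pn) = a(n)`; and `ZMod.unitsMap_surjective` for the
passage from unit-invariance to gcd-classes.

Everything is proved; the definitions are `primePlace` and `primeUnit`.

## References

* R. Meyer, *On a representation of the idele class group related to primes and zeros of
  L-functions*, Duke Math. J. 127 (2005) = arXiv:math/0311468, §5.2 [Meyer2005].
-/

noncomputable section

open IsDedekindDomain NumberField
open scoped Classical

namespace Literature.NumberTheory.Automorphic.Meyer

/-! ### Finite places of `ℚ` and valuations of integers -/

section Places

/-- The finite place of `ℚ` attached to a prime number. [folklore] -/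
def primePlace (p : Nat.Primes) : HeightOneSpectrum (𝓞 ℚ) :=
  Rat.HeightOneSpectrum.primesEquiv.symm p

/-- The prime of `primePlace p` is `p`. [folklore] -/
@[simp]
theorem primesEquiv_primePlace (p : Nat.Primes) : Rat.HeightOneSpectrum.primesEquiv (primePlace p) = p :=
  Equiv.apply_symm_apply _ p

/-- **Valuation of an integer at a finite place of `ℚ`**: it is `1` iff the prime does not divide
the integer. [folklore] -/
theorem valuation_intCast_eq_one_iff (v : HeightOneSpectrum (𝓞 ℚ)) (m : ℤ) :
    v.valuation ℚ (m : ℚ) = 1 ↔ ¬ ((Rat.HeightOneSpectrum.primesEquiv v : ℕ) : ℤ) ∣ m := by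
  haveI : Fact (Rat.HeightOneSpectrum.primesEquiv v : ℕ).Prime := ⟨(Rat.HeightOneSpectrum.primesEquiv v).2⟩
  rw [(Rat.HeightOneSpectrum.valuation_equiv_padicValuation v).eq_one_iff_eq_one, Rat.padicValuation_cast,
    Int.padicValuation_eq_one_iff]

/-- The valuation of an integer is `< 1` iff the prime divides it. [folklore] -/
theorem valuation_intCast_lt_one_iff (v : HeightOneSpectrum (𝓞 ℚ)) (m : ℤ) :
    v.valuation ℚ (m : ℚ) < 1 ↔ ((Rat.HeightOneSpectrum.primesEquiv v : ℕ) : ℤ) ∣ m := by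
  haveI : Fact (Rat.HeightOneSpectrum.primesEquiv v : ℕ).Prime := ⟨(Rat.HeightOneSpectrum.primesEquiv v).2⟩
  rw [(Rat.HeightOneSpectrum.valuation_equiv_padicValuation v).lt_one_iff_lt_one, Rat.padicValuation_cast,
    Int.padicValuation_lt_one_iff]

/-- The valuation of an integer is `≤ 1`. [folklore] -/
theorem valuation_intCast_le_one (v : HeightOneSpectrum (𝓞 ℚ)) (m : ℤ) : v.valuation ℚ (m : ℚ) ≤ 1 := by
  haveI : Fact (Rat.HeightOneSpectrum.primesEquiv v : ℕ).Prime := ⟨(Rat.HeightOneSpectrum.primesEquiv v).2⟩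
  rw [(Rat.HeightOneSpectrum.valuation_equiv_padicValuation v).le_one_iff_le_one, Rat.padicValuation_cast]
  exact Int.padicValuation_le_one _ _

/-- At the place of `p`, the prime `p` has valuation `< 1`. [folklore] -/
theorem valuation_prime_lt_one (p : Nat.Primes) : (primePlace p).valuation ℚ ((p : ℕ) : ℚ) < 1 := by
  have h := (valuation_intCast_lt_one_iff (primePlace p) (p : ℕ)).mpr (by simp)
  exact_mod_cast h

/-- Away from the place of `p`, the prime `p` is a unit. [folklore] -/
theorem valuation_prime_eq_one {p : Nat.Primes} {w : HeightOneSpectrum (𝓞 ℚ)} (hw : w ≠ primePlace p) :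
    w.valuation ℚ ((p : ℕ) : ℚ) = 1 := by
  have h := (valuation_intCast_eq_one_iff w (p : ℕ)).mpr ?_
  · exact_mod_cast h
  · intro hdvd
    apply hw
    -- two primes dividing each other are equal
    have hq : (Rat.HeightOneSpectrum.primesEquiv w : ℕ) ∣ (p : ℕ) := by exact_mod_cast hdvd
    have heq : (Rat.HeightOneSpectrum.primesEquiv w : ℕ) = (p : ℕ) :=
      (Nat.prime_dvd_prime_iff_eq (Rat.HeightOneSpectrum.primesEquiv w).2 p.2).mp hq
    apply Rat.HeightOneSpectrum.primesEquiv.injective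
    rw [primesEquiv_primePlace]
    exact Subtype.ext heq

/-- An integer coprime to `p` is a unit at the place of `p`. [folklore] -/
theorem valuation_primePlace_eq_one_of_not_dvd {p : Nat.Primes} {m : ℤ} (h : ¬ ((p : ℕ) : ℤ) ∣ m) :
    (primePlace p).valuation ℚ (m : ℚ) = 1 := by
  rw [valuation_intCast_eq_one_iff, primesEquiv_primePlace]
  exact h

end Places

/-- The radius of the level ideal `(N) ⊆ 𝓞 ℚ` at `v` is `|N|_v` (also proved, as
`Rat.idealRadius_span_natCast`, in `NewformAdelisation`, which is not imported into this cone;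
librarian merge). [folklore] -/
theorem idealRadius_span_natCast' (v : HeightOneSpectrum (𝓞 ℚ)) {N : ℕ} (hN : N ≠ 0) :
    idealRadius ℚ v (Ideal.span {(N : 𝓞 ℚ)}) = v.valuation ℚ (N : ℚ) := by
  have hN' : (N : 𝓞 ℚ) ≠ 0 := by exact_mod_cast hN
  have hI : (Ideal.span {(N : 𝓞 ℚ)} : Ideal (𝓞 ℚ)) ≠ 0 := by
    rw [Ne, Ideal.zero_eq_bot, Ideal.span_singleton_eq_bot]
    exact hN'
  rw [idealRadius, FractionalIdeal.count_coe ℚ v hI, ← map_natCast (algebraMap (𝓞 ℚ) ℚ) N,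
    HeightOneSpectrum.valuation_of_algebraMap, HeightOneSpectrum.intValuation_if_neg v hN']

/-- A rational number integral at every finite place is an integer (also in `NewformAdelisation`
as `Rat.exists_intCast_eq_of_valuation_le_one`; librarian merge). [folklore] -/
theorem exists_intCast_eq_of_valuation_le_one' {q : ℚ}
    (h : ∀ v : HeightOneSpectrum (𝓞 ℚ), v.valuation ℚ q ≤ 1) : ∃ z : ℤ, (z : ℚ) = q := by
  obtain ⟨x, hx⟩ := HeightOneSpectrum.mem_integers_of_valuation_le_one ℚ q h
  refine ⟨Rat.ringOfIntegersEquiv x, ?_⟩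
  rw [Rat.ringOfIntegersEquiv_apply_coe]
  exact hx

/-! ### The unit `û = p + (1 - p) δ_p ∈ Ẑˣ` -/

section PrimeUnit

variable (p : Nat.Primes)

/-- Shorthand: the finite adele of a rational number. [folklore] -/
abbrev ratAdele (q : ℚ) : FiniteAdeleRing (𝓞 ℚ) ℚ := algebraMap ℚ (FiniteAdeleRing (𝓞 ℚ) ℚ) q

/-- Components add. [folklore] -/
theorem FiniteAdeleRing.add_apply'' (x y : FiniteAdeleRing (𝓞 ℚ) ℚ) (v : HeightOneSpectrum (𝓞 ℚ)) :
    (x + y) v = x v + y v := rfl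

/-- The valuation of the `v`-component of the adele of `q` is `|q|_v`. [folklore] -/
theorem valued_ratAdele (q : ℚ) (v : HeightOneSpectrum (𝓞 ℚ)) : Valued.v (ratAdele q v) = v.valuation ℚ q := by
  rw [ratAdele, FiniteAdeleRing.algebraMap_apply, HeightOneSpectrum.valuedAdicCompletion_eq_valuation']

/-- The finite adele `û = p + (1 - p)δ_p`: component `1` at `p`, component `p` elsewhere. [folklore] -/
def primeUnitVal : FiniteAdeleRing (𝓞 ℚ) ℚ :=
  ratAdele ((p : ℕ) : ℚ) + finiteAdeleSingleHom ℚ (primePlace p) (1 - ratAdele ((p : ℕ) : ℚ) (primePlace p))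

/-- Its inverse `p⁻¹ + (1 - p⁻¹)δ_p`. [folklore] -/
def primeUnitInv : FiniteAdeleRing (𝓞 ℚ) ℚ :=
  ratAdele (((p : ℕ) : ℚ)⁻¹) + finiteAdeleSingleHom ℚ (primePlace p) (1 - ratAdele (((p : ℕ) : ℚ)⁻¹) (primePlace p))

/-- Component at `p`. [folklore] -/
theorem primeUnitVal_apply_self : primeUnitVal p (primePlace p) = 1 := by
  rw [primeUnitVal, FiniteAdeleRing.add_apply'', finiteAdeleSingleHom_apply_self]
  ring

/-- Components away from `p`. [folklore] -/
theorem primeUnitVal_apply_of_ne {w : HeightOneSpectrum (𝓞 ℚ)} (hw : w ≠ primePlace p) :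
    primeUnitVal p w = ratAdele ((p : ℕ) : ℚ) w := by
  rw [primeUnitVal, FiniteAdeleRing.add_apply'', finiteAdeleSingleHom_apply_of_ne _ _ _ hw, add_zero]

/-- Component of the inverse at `p`. [folklore] -/
theorem primeUnitInv_apply_self : primeUnitInv p (primePlace p) = 1 := by
  rw [primeUnitInv, FiniteAdeleRing.add_apply'', finiteAdeleSingleHom_apply_self]
  ring

/-- Components of the inverse away from `p`. [folklore] -/
theorem primeUnitInv_apply_of_ne {w : HeightOneSpectrum (𝓞 ℚ)} (hw : w ≠ primePlace p) :
    primeUnitInv p w = ratAdele (((p : ℕ) : ℚ)⁻¹) w := by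
  rw [primeUnitInv, FiniteAdeleRing.add_apply'', finiteAdeleSingleHom_apply_of_ne _ _ _ hw, add_zero]

/-- `û û⁻¹ = 1`. [folklore] -/
theorem primeUnitVal_mul_inv : primeUnitVal p * primeUnitInv p = 1 := by
  have hp : ((p : ℕ) : ℚ) ≠ 0 := by exact_mod_cast p.2.ne_zero
  refine FiniteAdeleRing.ext ℚ fun w => ?_
  rw [FiniteAdeleRing.mul_apply']
  by_cases hw : w = primePlace p
  · subst hw
    rw [primeUnitVal_apply_self, primeUnitInv_apply_self, one_mul]
    rfl
  · rw [primeUnitVal_apply_of_ne p hw, primeUnitInv_apply_of_ne p hw, ← FiniteAdeleRing.mul_apply', ratAdele, ratAdele,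
      ← map_mul, mul_inv_cancel₀ hp, map_one]

/-- `û⁻¹ û = 1`. [folklore] -/
theorem primeUnitInv_mul_val : primeUnitInv p * primeUnitVal p = 1 := by
  rw [mul_comm, primeUnitVal_mul_inv]

/-- **The finite idele unit `û = p + (1 - p)δ_p`.** [folklore] -/
def primeUnit : (FiniteAdeleRing (𝓞 ℚ) ℚ)ˣ :=
  ⟨primeUnitVal p, primeUnitInv p, primeUnitVal_mul_inv p, primeUnitInv_mul_val p⟩

/-- The underlying adele of `primeUnit p`. [folklore] -/
@[simp]
theorem coe_primeUnit : (primeUnit p : FiniteAdeleRing (𝓞 ℚ) ℚ) = primeUnitVal p := rfl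

/-- The underlying adele of `(primeUnit p)⁻¹`. [folklore] -/
@[simp]
theorem coe_primeUnit_inv : ((primeUnit p)⁻¹ : (FiniteAdeleRing (𝓞 ℚ) ℚ)ˣ) = primeUnitInv p := rfl

/-- **`û ∈ Ẑˣ`.** [folklore] -/
theorem primeUnit_mem_integralFiniteUnits : primeUnit p ∈ integralFiniteUnits ℚ := by
  intro w
  rw [HeightOneSpectrum.mem_adicCompletionIntegers, HeightOneSpectrum.mem_adicCompletionIntegers,
    coe_primeUnit]
  change Valued.v (primeUnitVal p w) ≤ 1 ∧ Valued.v (primeUnitInv p w) ≤ 1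
  by_cases hw : w = primePlace p
  · subst hw
    rw [primeUnitVal_apply_self, primeUnitInv_apply_self, Valuation.map_one]
    exact ⟨le_rfl, le_rfl⟩
  · rw [primeUnitVal_apply_of_ne p hw, primeUnitInv_apply_of_ne p hw, valued_ratAdele, valued_ratAdele, map_inv₀,
      valuation_prime_eq_one hw, inv_one]
    exact ⟨le_rfl, le_rfl⟩

/-- **`û ≡ p (mod level)` on integral vectors**: for `x` integral at `p` and a level `N₂` prime to
`p`, `û x - p x` lies in the level ideal `N₂ Ẑ`. [folklore] -/
theorem primeUnit_mul_sub_mem_levelIdeal {N₂ : ℕ} (hN₂ : N₂ ≠ 0) (hpN : ¬ (p : ℕ) ∣ N₂)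
    {x : FiniteAdeleRing (𝓞 ℚ) ℚ} (hx : Valued.v (x (primePlace p)) ≤ 1) :
    primeUnitVal p * x - ratAdele ((p : ℕ) : ℚ) * x ∈ levelIdeal ℚ (Ideal.span {(N₂ : 𝓞 ℚ)}) := by
  rw [mem_levelIdeal_iff]
  intro w
  rw [idealRadius_span_natCast' w hN₂, FiniteAdeleRing.sub_apply', FiniteAdeleRing.mul_apply',
    FiniteAdeleRing.mul_apply']
  by_cases hw : w = primePlace p
  · subst hw
    rw [primeUnitVal_apply_self, one_mul, ← one_sub_mul, Valuation.map_mul]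
    have hN : (primePlace p).valuation ℚ (N₂ : ℚ) = 1 := by
      have := valuation_primePlace_eq_one_of_not_dvd (p := p) (m := (N₂ : ℤ)) (by exact_mod_cast hpN)
      exact_mod_cast this
    rw [hN]
    have h1 : Valued.v (1 - ratAdele ((p : ℕ) : ℚ) (primePlace p)) ≤ 1 := by
      have := valued_ratAdele (1 - ((p : ℕ) : ℚ)) (primePlace p)
      rw [ratAdele, map_sub, map_one] at this
      change Valued.v (1 - ratAdele ((p : ℕ) : ℚ) (primePlace p)) = _ at this
      rw [this]
      have := valuation_intCast_le_one (primePlace p) (1 - (p : ℕ) : ℤ)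
      exact_mod_cast this
    calc Valued.v (1 - ratAdele ((p : ℕ) : ℚ) (primePlace p)) * Valued.v (x (primePlace p)) ≤ 1 * 1 :=
          mul_le_mul' h1 hx
      _ = 1 := one_mul 1
  · rw [primeUnitVal_apply_of_ne p hw, sub_self, Valuation.map_zero]
    exact zero_le

end PrimeUnit

/-! ### Level, denominator and the rational sequence of an invariant Schwartz–Bruhat function -/

section Invariant

variable {Φ : FiniteAdeleRing (𝓞 ℚ) ℚ → ℂ}

/-- A scalar Schwartz–Bruhat function as a function of `Fin 1 → 𝔸_ℚ^∞`. [folklore] -/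
theorem comp_eval_mem_schwartzBruhat (hΦ : Φ ∈ SchwartzBruhat (FiniteAdeleRing (𝓞 ℚ) ℚ)) :
    (fun y : Fin 1 → FiniteAdeleRing (𝓞 ℚ) ℚ => Φ (y 0)) ∈ SchwartzBruhat (Fin 1 → FiniteAdeleRing (𝓞 ℚ) ℚ) := by
  obtain ⟨hlc, hcs⟩ := (mem_schwartzBruhat_iff).1 hΦ
  exact (mem_schwartzBruhat_iff).2 ⟨hlc.comp_continuous (continuous_apply 0),
    hcs.comp_homeomorph (Homeomorph.funUnique (Fin 1) (FiniteAdeleRing (𝓞 ℚ) ℚ))⟩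

/-- **A Schwartz–Bruhat function on `𝔸_ℚ^∞` has a natural level**: `Φ(x + l) = Φ(x)` for all
`l ∈ N₂ Ẑ`. [folklore] -/
theorem exists_natLevel (hΦ : Φ ∈ SchwartzBruhat (FiniteAdeleRing (𝓞 ℚ) ℚ)) :
    ∃ N₂ : ℕ, N₂ ≠ 0 ∧ ∀ x, ∀ l ∈ levelIdeal ℚ (Ideal.span {(N₂ : 𝓞 ℚ)}), Φ (x + l) = Φ x := by
  obtain ⟨𝔫, h𝔫, hlev⟩ := exists_level_of_mem_schwartzBruhat ℚ (comp_eval_mem_schwartzBruhat hΦ)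
  set N₂ : ℕ := Ideal.absNorm 𝔫 with hN₂
  have hN₂0 : N₂ ≠ 0 := by
    rw [hN₂, Ne, Ideal.absNorm_eq_zero_iff]
    exact h𝔫
  have hle : Ideal.span {(N₂ : 𝓞 ℚ)} ≤ 𝔫 := by
    rw [Ideal.span_le, Set.singleton_subset_iff]
    exact Ideal.absNorm_mem 𝔫
  have hspan0 : Ideal.span {(N₂ : 𝓞 ℚ)} ≠ 0 := by
    rw [Ne, Ideal.zero_eq_bot, Ideal.span_singleton_eq_bot]
    exact_mod_cast hN₂0
  refine ⟨N₂, hN₂0, fun x l hl => ?_⟩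
  have hl' : l ∈ levelIdeal ℚ 𝔫 := levelIdeal_mono ℚ hspan0 hle hl
  have h := hlev (fun _ => x) (fun _ => l) ((mem_piLevelIdeal_iff ℚ).2 fun _ => hl')
  exact h

/-- **A Schwartz–Bruhat function on `𝔸_ℚ^∞` has a natural denominator on the rationals**:
`Φ(q) ≠ 0` forces `N₁ q ∈ ℤ`. [folklore] -/
theorem exists_natDenominator (hΦ : Φ ∈ SchwartzBruhat (FiniteAdeleRing (𝓞 ℚ) ℚ)) :
    ∃ N₁ : ℕ, N₁ ≠ 0 ∧ ∀ q : ℚ, Φ (ratAdele q) ≠ 0 → ∃ m : ℤ, q = m / N₁ := by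
  obtain ⟨d, hd, hden⟩ := exists_denominator_of_mem_schwartzBruhat ℚ (comp_eval_mem_schwartzBruhat hΦ)
  set dz : ℤ := Rat.ringOfIntegersEquiv d with hdz
  have hdq : ((dz : ℤ) : ℚ) = (d : ℚ) := by rw [hdz, Rat.ringOfIntegersEquiv_apply_coe]
  have hdz0 : dz ≠ 0 := by
    intro h0
    apply hd
    have : (d : ℚ) = 0 := by rw [← hdq, h0, Int.cast_zero]
    exact_mod_cast this
  refine ⟨dz.natAbs, Int.natAbs_ne_zero.mpr hdz0, fun q hq => ?_⟩
  -- `d q` is integral at every finite place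
  have hint : ∀ v : HeightOneSpectrum (𝓞 ℚ), v.valuation ℚ ((dz : ℚ) * q) ≤ 1 := by
    intro v
    have h := hden (fun _ => ratAdele q) hq 0 v
    rw [HeightOneSpectrum.mem_adicCompletionIntegers] at h
    have halg : algebraMap (𝓞 ℚ) (FiniteAdeleRing (𝓞 ℚ) ℚ) d = ratAdele (d : ℚ) :=
      IsScalarTower.algebraMap_apply (𝓞 ℚ) ℚ (FiniteAdeleRing (𝓞 ℚ) ℚ) d
    rw [halg, ← hdq] at h
    change Valued.v ((ratAdele (dz : ℚ) * ratAdele q) v) ≤ 1 at h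
    rwa [ratAdele, ratAdele, ← map_mul, ← ratAdele, valued_ratAdele] at h
  obtain ⟨z, hz⟩ := exists_intCast_eq_of_valuation_le_one' hint
  -- `q = z / dz = (± z) / |dz|`
  have hdzq : (dz : ℚ) ≠ 0 := by exact_mod_cast hdz0
  have hq' : q = (z : ℚ) / (dz : ℚ) := by
    rw [hz]; field_simp
  rcases Int.natAbs_eq dz with h | h
  · refine ⟨z, ?_⟩
    have hc : (dz : ℚ) = ((dz.natAbs : ℕ) : ℚ) := by
      have := congrArg (fun t : ℤ => (t : ℚ)) h
      simpa only [Int.cast_natCast] using this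
    rw [hq', hc]
  · refine ⟨-z, ?_⟩
    have hc : (dz : ℚ) = -((dz.natAbs : ℕ) : ℚ) := by
      have := congrArg (fun t : ℤ => (t : ℚ)) h
      simpa only [Int.cast_neg, Int.cast_natCast] using this
    rw [hq', hc, div_neg, Int.cast_neg, neg_div]

/-- The adele of `N₂ k` lies in the level ideal `N₂ Ẑ`. [folklore] -/
theorem ratAdele_mul_mem_levelIdeal {N₂ : ℕ} (hN₂ : N₂ ≠ 0) (k : ℤ) :
    ratAdele ((N₂ : ℚ) * k) ∈ levelIdeal ℚ (Ideal.span {(N₂ : 𝓞 ℚ)}) := by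
  rw [mem_levelIdeal_iff]
  intro v
  rw [idealRadius_span_natCast' v hN₂, valued_ratAdele, map_mul]
  exact mul_le_of_le_one_right zero_le (valuation_intCast_le_one v k)

variable (Φ) in
/-- The rational sequence `a(m) = Φ(m / N₁)` of `Φ`. [folklore] -/
def ratSeq (N₁ : ℕ) (m : ℤ) : ℂ := Φ (ratAdele ((m : ℚ) / N₁))

/-- **Periodicity**: `a(m + N₁ N₂ k) = a(m)` for a level `N₂`. [folklore] -/
theorem ratSeq_add_mul {N₁ N₂ : ℕ} (hN₁ : N₁ ≠ 0) (hN₂ : N₂ ≠ 0)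
    (hlev : ∀ x, ∀ l ∈ levelIdeal ℚ (Ideal.span {(N₂ : 𝓞 ℚ)}), Φ (x + l) = Φ x) (m k : ℤ) :
    ratSeq Φ N₁ (m + (N₁ * N₂ : ℕ) * k) = ratSeq Φ N₁ m := by
  have hN₁q : (N₁ : ℚ) ≠ 0 := by exact_mod_cast hN₁
  rw [ratSeq, ratSeq]
  have hsplit : (((m + (N₁ * N₂ : ℕ) * k : ℤ) : ℚ) / N₁) = (m : ℚ) / N₁ + (N₂ : ℚ) * k := by
    push_cast
    field_simp
  rw [hsplit, ratAdele, map_add]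
  exact hlev _ _ (ratAdele_mul_mem_levelIdeal hN₂ k)

/-- **The unit step**: for a prime `p` exceeding `N₁ N₂`, `a(p m) = a(m)` — `Ẑˣ`-invariance at
`û = p + (1-p)δ_p` plus level invariance. [cite: Meyer2005, §5.2] -/
theorem ratSeq_prime_mul {N₁ N₂ : ℕ} (hN₁ : N₁ ≠ 0) (hN₂ : N₂ ≠ 0)
    (hlev : ∀ x, ∀ l ∈ levelIdeal ℚ (Ideal.span {(N₂ : 𝓞 ℚ)}), Φ (x + l) = Φ x)
    (hinv : ∀ u ∈ integralFiniteUnits ℚ, ∀ x, Φ ((u : FiniteAdeleRing (𝓞 ℚ) ℚ) * x) = Φ x)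
    {p : Nat.Primes} (hp : N₁ * N₂ < (p : ℕ)) (m : ℤ) :
    ratSeq Φ N₁ ((p : ℕ) * m) = ratSeq Φ N₁ m := by
  have hN₁q : (N₁ : ℚ) ≠ 0 := by exact_mod_cast hN₁
  have hp1 : ¬ (p : ℕ) ∣ N₁ := fun h => by
    have := Nat.le_of_dvd (Nat.pos_of_ne_zero hN₁) h
    have : N₁ ≤ N₁ * N₂ := Nat.le_mul_of_pos_right _ (Nat.pos_of_ne_zero hN₂)
    omega
  have hp2 : ¬ (p : ℕ) ∣ N₂ := fun h => by
    have := Nat.le_of_dvd (Nat.pos_of_ne_zero hN₂) h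
    have : N₂ ≤ N₁ * N₂ := Nat.le_mul_of_pos_left _ (Nat.pos_of_ne_zero hN₁)
    omega
  set x : FiniteAdeleRing (𝓞 ℚ) ℚ := ratAdele ((m : ℚ) / N₁) with hx
  -- `x` is integral at `p`
  have hxint : Valued.v (x (primePlace p)) ≤ 1 := by
    rw [hx, valued_ratAdele, map_div₀]
    have hN : (primePlace p).valuation ℚ (N₁ : ℚ) = 1 := by
      have := valuation_primePlace_eq_one_of_not_dvd (p := p) (m := (N₁ : ℤ)) (by exact_mod_cast hp1)
      exact_mod_cast this
    rw [hN, div_one]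
    exact valuation_intCast_le_one _ m
  have h1 : Φ (primeUnitVal p * x) = Φ x := hinv (primeUnit p) (primeUnit_mem_integralFiniteUnits p) x
  have h2 : Φ (ratAdele ((p : ℕ) : ℚ) * x) = Φ (primeUnitVal p * x) := by
    have hl := primeUnit_mul_sub_mem_levelIdeal p hN₂ hp2 hxint
    have hneg := (levelIdeal ℚ (Ideal.span {(N₂ : 𝓞 ℚ)})).neg_mem hl
    have := hlev (primeUnitVal p * x) _ hneg
    rw [← this]
    congr 1
    ring
  rw [ratSeq, ratSeq]
  have hpm : (((p : ℕ) * m : ℤ) : ℚ) / N₁ = ((p : ℕ) : ℚ) * ((m : ℚ) / N₁) := by push_cast; ring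
  rw [hpm, ratAdele, map_mul]
  change Φ (ratAdele ((p : ℕ) : ℚ) * x) = Φ x
  rw [h2, h1]

/-- **Unit invariance**: `a(u m) = a(m)` for every integer `u` coprime to `M = N₁ N₂` (Dirichlet's
theorem supplies a prime `p ≡ u (mod M)`, `p > M`). [cite: Meyer2005, §5.2] -/
theorem ratSeq_unit_mul {N₁ N₂ : ℕ} (hN₁ : N₁ ≠ 0) (hN₂ : N₂ ≠ 0)
    (hlev : ∀ x, ∀ l ∈ levelIdeal ℚ (Ideal.span {(N₂ : 𝓞 ℚ)}), Φ (x + l) = Φ x)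
    (hinv : ∀ u ∈ integralFiniteUnits ℚ, ∀ x, Φ ((u : FiniteAdeleRing (𝓞 ℚ) ℚ) * x) = Φ x)
    {u : ℤ} (hu : IsCoprime u (N₁ * N₂ : ℕ)) (m : ℤ) :
    ratSeq Φ N₁ (u * m) = ratSeq Φ N₁ m := by
  have hM : (N₁ * N₂ : ℕ) ≠ 0 := Nat.mul_ne_zero hN₁ hN₂
  obtain ⟨p, hpM, hpp, hpu⟩ := Nat.forall_exists_prime_gt_and_zmodEq (N₁ * N₂) hM hu
  -- `u m ≡ p m (mod M)`
  have hmod : u * m ≡ (p : ℤ) * m [ZMOD ((N₁ * N₂ : ℕ) : ℤ)] := (hpu.symm.mul_right m)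
  obtain ⟨k, hk⟩ := (Int.modEq_iff_dvd.mp hmod.symm)
  -- `hk : u * m - p * m = M * k`
  have heq : u * m = (p : ℤ) * m + (N₁ * N₂ : ℕ) * k := by linarith
  rw [heq, ratSeq_add_mul hN₁ hN₂ hlev]
  exact ratSeq_prime_mul hN₁ hN₂ hlev hinv (p := ⟨p, hpp⟩) hpM m

/-- **Gcd classes**: `a(m) = a(gcd(m, M))` for `m ≠ 0`. [cite: Meyer2005, §5.2] -/
theorem ratSeq_eq_ratSeq_gcd {N₁ N₂ : ℕ} (hN₁ : N₁ ≠ 0) (hN₂ : N₂ ≠ 0)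
    (hlev : ∀ x, ∀ l ∈ levelIdeal ℚ (Ideal.span {(N₂ : 𝓞 ℚ)}), Φ (x + l) = Φ x)
    (hinv : ∀ u ∈ integralFiniteUnits ℚ, ∀ x, Φ ((u : FiniteAdeleRing (𝓞 ℚ) ℚ) * x) = Φ x)
    {m : ℤ} (hm : m ≠ 0) :
    ratSeq Φ N₁ m = ratSeq Φ N₁ (Int.gcd m (N₁ * N₂ : ℕ) : ℕ) := by
  set M : ℕ := N₁ * N₂ with hMdef
  have hM : M ≠ 0 := Nat.mul_ne_zero hN₁ hN₂
  haveI : NeZero M := ⟨hM⟩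
  set g : ℕ := Int.gcd m (M : ℤ) with hg
  have hg0 : 0 < g := Int.gcd_pos_of_ne_zero_left _ hm
  have hgm : (g : ℤ) ∣ m := Int.gcd_dvd_left ..
  have hgM : (g : ℤ) ∣ (M : ℤ) := Int.gcd_dvd_right ..
  have hgMn : g ∣ M := by exact_mod_cast hgM
  obtain ⟨m', hm'⟩ := hgm
  obtain ⟨M', hM'⟩ := hgMn
  have hM'0 : M' ≠ 0 := fun h => hM (by rw [hM', h, mul_zero])
  have hcop : Int.gcd m' (M' : ℤ) = 1 := by
    have h := Int.gcd_div_gcd_div_gcd hg0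
    have e1 : m / (g : ℤ) = m' := by
      rw [hm']; exact Int.mul_ediv_cancel_left _ (by exact_mod_cast hg0.ne')
    have e2 : (M : ℤ) / (g : ℤ) = (M' : ℤ) := by
      rw [hM']; push_cast; exact Int.mul_ediv_cancel_left _ (by exact_mod_cast hg0.ne')
    rw [← hg] at h
    rwa [e1, e2] at h
  have hunit : IsUnit ((m' : ℤ) : ZMod M') := by
    rw [ZMod.coe_int_isUnit_iff_isCoprime]
    exact (Int.isCoprime_iff_gcd_eq_one.mpr hcop).symm
  have hdvd : M' ∣ M := ⟨g, by rw [hM', mul_comm]⟩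
  obtain ⟨U, hU⟩ := ZMod.unitsMap_surjective hdvd hunit.unit
  set u₀ : ℕ := (U : ZMod M).val with hu₀
  have hu₀cop : Nat.Coprime u₀ M := ZMod.val_coe_unit_coprime U
  have hu₀mod : ((u₀ : ℤ) : ZMod M') = ((m' : ℤ) : ZMod M') := by
    have h1 : ((ZMod.unitsMap hdvd U : (ZMod M')ˣ) : ZMod M') = ((m' : ℤ) : ZMod M') := by
      rw [hU]; rfl
    rw [ZMod.unitsMap_def, Units.coe_map, MonoidHom.coe_coe, ZMod.castHom_apply, ZMod.cast_eq_val] at h1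
    rw [Int.cast_natCast]
    exact h1
  have hmod : (u₀ : ℤ) ≡ m' [ZMOD (M' : ℤ)] := (ZMod.intCast_eq_intCast_iff _ _ _).mp hu₀mod
  -- `u₀ g ≡ m' g = m (mod M)`
  have hmod2 : (u₀ : ℤ) * g ≡ m [ZMOD (M : ℤ)] := by
    have h := Int.ModEq.mul_right' (c := (g : ℤ)) hmod
    rw [show (m' : ℤ) * g = m by rw [hm']; ring] at h
    have hMg : (M : ℤ) = (M' : ℤ) * g := by rw [hM']; push_cast; ring
    rwa [hMg]
  obtain ⟨k, hk⟩ := Int.modEq_iff_dvd.mp hmod2.symm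
  have heq : m = (u₀ : ℤ) * g + (M : ℤ) * (-k) := by linarith
  have hucop : IsCoprime (u₀ : ℤ) (M : ℕ) := by
    rw [Int.isCoprime_iff_gcd_eq_one, Int.gcd_natCast_natCast]
    exact hu₀cop
  calc ratSeq Φ N₁ m = ratSeq Φ N₁ ((u₀ : ℤ) * g + (N₁ * N₂ : ℕ) * (-k)) := by rw [← heq]
    _ = ratSeq Φ N₁ ((u₀ : ℤ) * g) := ratSeq_add_mul hN₁ hN₂ hlev _ _
    _ = ratSeq Φ N₁ g := ratSeq_unit_mul hN₁ hN₂ hlev hinv hucop _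

/-- **Main theorem of the file.** For a `Ẑˣ`-invariant Schwartz–Bruhat function `Φ` on `𝔸_ℚ^∞`
there are `N₁, M ≥ 1` and a gcd-class sequence `a : ℕ → ℂ` (`a(n) = a(gcd(n, M))`) with
`Φ(m/N₁) = a(gcd(|m|, M))` for all integers `m ≠ 0`, and `Φ(q) = 0` unless `N₁ q ∈ ℤ`.
[cite: Meyer2005, §5.2] -/
theorem exists_gcd_seq_of_invariant (hΦ : Φ ∈ SchwartzBruhat (FiniteAdeleRing (𝓞 ℚ) ℚ))
    (hinv : ∀ u ∈ integralFiniteUnits ℚ, ∀ x, Φ ((u : FiniteAdeleRing (𝓞 ℚ) ℚ) * x) = Φ x) :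
    ∃ N₁ M : ℕ, N₁ ≠ 0 ∧ M ≠ 0 ∧
      (∀ q : ℚ, Φ (ratAdele q) ≠ 0 → ∃ m : ℤ, q = m / N₁) ∧
      ∃ a : ℕ → ℂ, (∀ n, n ≠ 0 → a n = a (Nat.gcd n M)) ∧
        ∀ m : ℤ, m ≠ 0 → Φ (ratAdele ((m : ℚ) / N₁)) = a (Int.gcd m M) := by
  obtain ⟨N₁, hN₁, hden⟩ := exists_natDenominator hΦ
  obtain ⟨N₂, hN₂, hlev⟩ := exists_natLevel hΦ
  refine ⟨N₁, N₁ * N₂, hN₁, Nat.mul_ne_zero hN₁ hN₂, hden, fun n => ratSeq Φ N₁ n, fun n hn => ?_, fun m hm => ?_⟩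
  · have h := ratSeq_eq_ratSeq_gcd hN₁ hN₂ hlev hinv (m := (n : ℤ)) (by exact_mod_cast hn)
    rw [Int.gcd_natCast_natCast] at h
    exact h
  · exact ratSeq_eq_ratSeq_gcd hN₁ hN₂ hlev hinv hm

end Invariant

end Literature.NumberTheory.Automorphic.Meyer
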